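import Mathlib
import HarnessLib
import Summits.Ventures.LatticeQCDFlow.Exactness.U1FTHMCGaugeCovariance
import Summits.Ventures.LatticeQCDFlow.Scoring.WilsonStapleSum
import Literature.MathematicalPhysics.QuantumLattice.GaugeGroups
import Literature.MathematicalPhysics.QuantumFieldTheory.Balaban1983to89.InfiniteVolumeSufficientXX

/-!
# `U(1)` rung: the EXACT (autodiff) gradient of `β·S_W` along the drift IS `−βcκ` times the engine's leading-order Wilson-flow field `Z` — the force routine in closed form, and Lüscher's `Z = −∂S` on this rung

HONEST FRAMING: exact (Metropolis-corrected) sampling algorithms for lattice gauge theory;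
figures of merit are autocorrelation/cost numbers at stated couplings and volumes; no
continuum-physics claim.

Venture `LatticeQCDFlow` (cell pub-lqcd), topic `Exactness`; FANOUT row 14 (`eng-flowhmc`, `U(1)`
rung: links `GaugeConfig d L U(1)`, momenta `Edge d L → ℝ`, drift `V_e ← e^(icp_e) V_e`, Wilson
action in the defining representation `u1Rep` of the tree's `QuantumLattice/GaugeGroups`; its character
`trace_u1Rep` is the tree's, `Balaban1983to89/InfiniteVolumeSufficientXX`).  NEW WORK of
the cell; nothing is cited as a fact; no number.  The abelian twin of `SU2ExactForceWilson`:
`U1FTHMCGaugeCovariance` (GEN-10) typed the exact force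
`g_κ V (e) = κ · fderiv ℝ (p ↦ S̃(e^(icp)·V)) 0 (Pi.single e 1)`; the engine's zero-parameter member
(`U1WilsonFlowLOSubstep`) moves the links along the field
`Z_e(V) = Σ_(ν ≠ μ) [Im U_(x−ν̂;μν) − Im U_(x;μν)]`, `e = (x, μ)`.  On every torus of side `L ≥ 2`:

* `differentiableAt_wilsonAction_circleDrift` — `p ↦ β S_W(e^(icp)·V)` is Fréchet differentiable
  (each link is `exp` of a linear function of `p`; plaquettes are products of links and conjugates);
* `circleDrift_smul_single` — along `p = s·e_e` the drift is the one-link update `Pi.mulSingle e (e^(ics))`;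
* `im_coe_mul_trace_stapleSum_u1` — `Im (V_e · tr R_e(V)) = Σ_ν [Im U_(x;μν) − Im U_(x−ν̂;μν)]`
  (row 16's staple sum `Scoring.stapleSum u1Rep`; the lower staple closes to the INVERSE plaquette,
  `U(1)` is abelian);
* **`u1ExactForce_wilson`** — for `L ≥ 2`, every `β, c, κ`, `V`, `e`:
  `κ · fderiv ℝ (p ↦ β S_W(e^(icp)·V)) 0 (Pi.single e 1) = −(βcκ) · Z_e(V)` — THE EXACT-GRADIENT
  FORCE ROUTINE OF `β·S_W` IS `−βcκ` TIMES THE LO FLOW FIELD (formulas VERBATIM as in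
  `exists_layers_u1WilsonFlowLO`): the member integrates minus the gradient of the action, Lüscher's
  flow equation read on the `U(1)` rung, and the HMC force of row 9 / row 14 has a closed form;
  **`u1ExactForceRoutine_eq_flowField`** — the same as an equality of routines `GaugeConfig → momenta`.

NOT CLAIMED: the pulled-back action of a non-identity member; `L = 1`; floating point; the
normalisation of `ε` against flow time; any number.
-/

noncomputable section

namespace Summit.Ventures.LatticeQCDFlow.Exactness

open MeasureTheory
open Literature.MathematicalPhysics.QuantumFieldTheory Literature.MathematicalPhysics.QuantumLattice
open Summit.Ventures.LatticeQCDFlow.Scoring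

variable {d L : ℕ}

/-! ## One-by-one matrices and the `U(1)` staple sum -/

section Algebra

/-- `tr (a·1 · M) = a · tr M` for `1 × 1` matrices. -/
theorem trace_scalar_mul_fin_one (a : ℂ) (M : Matrix (Fin 1) (Fin 1) ℂ) :
    (Matrix.scalar (Fin 1) a * M).trace = a * M.trace := by
  simp [Matrix.trace_fin_one, Matrix.mul_apply, Matrix.scalar_apply]

/-- **`Im (V_e · tr R_e) = Σ_ν [Im U_(x;μν) − Im U_(x−ν̂;μν)]`**: the link times row 16's staple sum, in
the defining representation of the ABELIAN group `U(1)`; the upper staple closes to the plaquette at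
`x`, the lower one to the inverse of the plaquette at `x − ν̂`. -/
theorem im_coe_mul_trace_stapleSum_u1 (V : GaugeConfig d L Circle) (x : Site d L) (μ : Fin d) :
    (((V (x, μ) : Circle) : ℂ) * (stapleSum u1Rep V x μ).trace).im =
      ∑ ν ∈ Finset.univ.erase μ,
        (((plaquetteHolonomy V x μ ν : Circle) : ℂ).im - ((plaquetteHolonomy V (x - Pi.single ν 1) μ ν : Circle) : ℂ).im) := by
  rw [stapleSum_def, Matrix.trace_sum, Finset.mul_sum, Complex.im_sum]
  refine Finset.sum_congr rfl fun ν _ => ?_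
  have hup : V (x, μ) * stapleUp V x μ ν = plaquetteHolonomy V x μ ν :=
    (plaquetteHolonomy_eq_mul_stapleUp V x μ ν).symm
  have hdown : V (x, μ) * stapleDown V x μ ν = (plaquetteHolonomy V (x - Pi.single ν 1) μ ν)⁻¹ := by
    rw [← conj_plaquetteHolonomy_eq_mul_stapleDown, plaquetteHolonomy_comm_eq_inv, mul_comm, ← mul_assoc,
      mul_inv_cancel, one_mul]
  rw [Matrix.trace_add, trace_u1Rep, trace_u1Rep, mul_add, ← Circle.coe_mul, ← Circle.coe_mul, hup, hdown,
    Complex.add_im, Circle.coe_inv_eq_conj, Complex.conj_im]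
  ring

end Algebra

/-! ## The drift along a coordinate line -/

section Drift

/-- Along `p = s·e_e` the `U(1)` drift is the one-link update `Pi.mulSingle e (e^(ics))`. -/
theorem circleDrift_smul_single (c s : ℝ) (e₀ : Edge d L) :
    (fun i : Edge d L => Circle.exp (c * (s • (Pi.single e₀ (1 : ℝ) : (Edge d L → ℝ))) i)) = Pi.mulSingle e₀ (Circle.exp (c * s)) := by
  funext i
  by_cases hi : i = e₀
  · subst hi
    rw [Pi.mulSingle_eq_same, Pi.smul_apply, Pi.single_eq_same, smul_eq_mul, mul_one]
  · rw [Pi.mulSingle_eq_of_ne hi, Pi.smul_apply, Pi.single_eq_of_ne hi, smul_zero, mul_zero, Circle.exp_zero]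

end Drift

/-! ## Differentiability of the action along the drift -/

section Smooth

variable [NeZero L]

/-- Each drifted link, as a complex number, is a differentiable function of the momenta. -/
theorem differentiableAt_circleDrift_link (c : ℝ) (V : GaugeConfig d L Circle) (e : Edge d L) (p₀ : (Edge d L → ℝ)) :
    DifferentiableAt ℝ (fun p : (Edge d L → ℝ) => ((((fun i : Edge d L => Circle.exp (c * p i)) * V) e : Circle) : ℂ)) p₀ := by
  simp only [Pi.mul_apply, Circle.coe_mul, Circle.coe_exp]
  have h1 : DifferentiableAt ℝ (fun p : (Edge d L → ℝ) => (((c * p e : ℝ)) : ℂ)) p₀ :=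
    Complex.ofRealCLM.differentiableAt.comp p₀ ((differentiableAt_apply e p₀).const_mul c)
  exact (h1.mul_const Complex.I).cexp.mul_const _

/-- **`p ↦ β·S_W(e^(icp)·V)` is Fréchet differentiable** (everywhere). -/
theorem differentiableAt_wilsonAction_circleDrift (β c : ℝ) (V : GaugeConfig d L Circle) (p₀ : (Edge d L → ℝ)) :
    DifferentiableAt ℝ (fun p : (Edge d L → ℝ) => (fun W : GaugeConfig d L Circle => β * wilsonAction u1Rep W) ((fun i : Edge d L => Circle.exp (c * p i)) * V)) p₀ := by
  have hlink := differentiableAt_circleDrift_link c V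
  have hconj : Differentiable ℝ (fun z : ℂ => (starRingEnd ℂ) z) := Complex.conjCLE.differentiable
  have hhol : ∀ (x : Site d L) (μ ν : Fin d), DifferentiableAt ℝ (fun p : (Edge d L → ℝ) =>
      (((plaquetteHolonomy ((fun i : Edge d L => Circle.exp (c * p i)) * V) x μ ν) : Circle) : ℂ)) p₀ := by
    intro x μ ν
    simp only [plaquetteHolonomy, Circle.coe_mul, Circle.coe_inv_eq_conj]
    exact (((hlink _ p₀).mul (hlink _ p₀)).mul ((hconj.differentiableAt).comp p₀ (hlink _ p₀))).mul
      ((hconj.differentiableAt).comp p₀ (hlink _ p₀))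
  beta_reduce
  unfold wilsonAction
  refine DifferentiableAt.const_mul ?_ β
  refine DifferentiableAt.fun_sum fun pl _ => ?_
  refine DifferentiableAt.const_sub ?_ _
  simp only [trace_u1Rep]
  exact Complex.reCLM.differentiableAt.comp p₀ (hhol pl.1 pl.2.1.1 pl.2.1.2)

end Smooth

/-! ## The exact gradient of `β·S_W` is `−βcκ · Z` -/

section Main

variable [NeZero L]

/-- **THE EXACT (autodiff) FORCE OF `β·S_W` ALONG THE `U(1)` DRIFT IS `−βcκ` TIMES THE LO WILSON-FLOW
FIELD `Z`.**  For `L ≥ 2`, every `β, c, κ`, every field `V` and every link `e = (x, μ)`: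
`κ · fderiv ℝ (p ↦ β S_W(e^(icp)·V)) 0 (Pi.single e 1) = −(βcκ) · Σ_(ν ≠ μ) [Im U_(x−ν̂;μν) − Im U_(x;μν)]`. -/
theorem u1ExactForce_wilson (hL : 2 ≤ L) (β c κ : ℝ) (V : GaugeConfig d L Circle) :
    (fun i : Edge d L => κ * fderiv ℝ (fun p : (Edge d L → ℝ) => (fun W : GaugeConfig d L Circle => β * wilsonAction u1Rep W) ((fun i : Edge d L => Circle.exp (c * p i)) * V)) 0 (Pi.single i 1)) =
      (fun e : Edge d L => -(β * c * κ) * ∑ ν ∈ Finset.univ.erase e.2,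
            (((plaquetteHolonomy V (e.1 - Pi.single ν 1) e.2 ν : Circle) : ℂ).im -
              ((plaquetteHolonomy V e.1 e.2 ν : Circle) : ℂ).im)) := by
  funext e
  obtain ⟨x, μ⟩ := e
  -- the action along the drift and its differentiability at `p = 0`
  set f : (Edge d L → ℝ) → ℝ := fun p : (Edge d L → ℝ) => (fun W : GaugeConfig d L Circle => β * wilsonAction u1Rep W) ((fun i : Edge d L => Circle.exp (c * p i)) * V) with hf_def
  have hdiff : DifferentiableAt ℝ f 0 := differentiableAt_wilsonAction_circleDrift β c V 0
  set v : (Edge d L → ℝ) := Pi.single (x, μ) (1 : ℝ) with hv_def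
  set r : ℂ := (stapleSum u1Rep V x μ).trace with hr_def
  set m : ℂ := ((V (x, μ) : Circle) : ℂ) * r with hm_def
  -- (1) the action along the coordinate line, by row 16's staple form of the local action change
  have hline : ∀ s : ℝ, f (s • v) =
      β * ((wilsonAction u1Rep V + m.re) - (Complex.exp (((c * s : ℝ) : ℂ) * Complex.I) * m).re) := by
    intro s
    have hsub := wilsonAction_mulSingle_sub u1Rep hL continuous_u1Rep V x μ (Circle.exp (c * s))
    rw [hf_def, hv_def]
    beta_reduce
    rw [circleDrift_smul_single c s (x, μ)]
    have hW : wilsonAction u1Rep (Pi.mulSingle (x, μ) (Circle.exp (c * s)) * V) =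
        wilsonAction u1Rep V + m.re - (Complex.exp (((c * s : ℝ) : ℂ) * Complex.I) * m).re := by
      rw [sub_eq_iff_eq_add'.mp hsub]
      simp only [u1Rep_apply, trace_scalar_mul_fin_one, Circle.coe_mul, Circle.coe_exp, hm_def, hr_def, mul_assoc]
      ring
    rw [hW]
  -- (2) its derivative at `s = 0`
  have hexpC : HasDerivAt (fun s : ℝ => Complex.exp (((c * s : ℝ) : ℂ) * Complex.I)) (((c : ℝ) : ℂ) * Complex.I) 0 := by
    have h1 : HasDerivAt (fun s : ℝ => ((c * s : ℝ) : ℂ)) ((c : ℝ) : ℂ) 0 := by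
      have h := ((hasDerivAt_id (0 : ℝ)).const_mul c).ofReal_comp
      simpa using h
    have h2 := (h1.mul_const Complex.I).cexp
    simpa using h2
  have hg : HasDerivAt (fun s : ℝ => f (s • v)) (β * -((((c : ℝ) : ℂ) * Complex.I * m).re)) 0 := by
    have hm' : HasDerivAt (fun s : ℝ => Complex.exp (((c * s : ℝ) : ℂ) * Complex.I) * m) (((c : ℝ) : ℂ) * Complex.I * m) 0 :=
      hexpC.mul_const m
    have hre : HasDerivAt (fun s : ℝ => (Complex.exp (((c * s : ℝ) : ℂ) * Complex.I) * m).re)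
        ((((c : ℝ) : ℂ) * Complex.I * m).re) 0 :=
      Complex.reCLM.hasFDerivAt.comp_hasDerivAt 0 hm'
    have h := (hre.const_sub (wilsonAction u1Rep V + m.re)).const_mul β
    refine HasDerivAt.congr_of_eventuallyEq h (Filter.Eventually.of_forall fun s => ?_)
    exact hline s
  -- (3) the same derivative through `fderiv`
  have hcurve : HasDerivAt (fun s : ℝ => f (s • v)) (fderiv ℝ f 0 v) 0 := by
    have h0 : HasFDerivAt f (fderiv ℝ f 0) ((0 : ℝ) • v) := by
      rw [zero_smul]
      exact hdiff.hasFDerivAt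
    have h1 : HasDerivAt (fun s : ℝ => s • v) ((1 : ℝ) • v) 0 := (hasDerivAt_id (0 : ℝ)).smul_const v
    have h2 := h0.comp_hasDerivAt (0 : ℝ) h1
    rw [one_smul] at h2
    exact h2
  have hval : fderiv ℝ f 0 v = β * -((((c : ℝ) : ℂ) * Complex.I * m).re) := hcurve.unique hg
  -- (4) `Re (i c m) = −c Im m` and the abelian staple identity
  have hre : (((c : ℝ) : ℂ) * Complex.I * m).re = -(c * m.im) := by
    simp [Complex.mul_re, Complex.mul_im]
  have him : m.im = ∑ ν ∈ Finset.univ.erase μ,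
      (((plaquetteHolonomy V x μ ν : Circle) : ℂ).im - ((plaquetteHolonomy V (x - Pi.single ν 1) μ ν : Circle) : ℂ).im) := by
    rw [hm_def, hr_def]
    exact im_coe_mul_trace_stapleSum_u1 V x μ
  have hZ : ∑ ν ∈ Finset.univ.erase (x, μ).2,
            (((plaquetteHolonomy V ((x, μ).1 - Pi.single ν 1) (x, μ).2 ν : Circle) : ℂ).im -
              ((plaquetteHolonomy V (x, μ).1 (x, μ).2 ν : Circle) : ℂ).im) =
      -∑ ν ∈ Finset.univ.erase μ,
        (((plaquetteHolonomy V x μ ν : Circle) : ℂ).im - ((plaquetteHolonomy V (x - Pi.single ν 1) μ ν : Circle) : ℂ).im) := by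
    rw [← Finset.sum_neg_distrib]
    refine Finset.sum_congr rfl fun ν _ => ?_
    ring
  show κ * fderiv ℝ f 0 v = -(β * c * κ) * ∑ ν ∈ Finset.univ.erase (x, μ).2,
            (((plaquetteHolonomy V ((x, μ).1 - Pi.single ν 1) (x, μ).2 ν : Circle) : ℂ).im -
              ((plaquetteHolonomy V (x, μ).1 (x, μ).2 ν : Circle) : ℂ).im)
  rw [hval, hre, him, hZ]
  ring

/-- **The exact-gradient force routine of `β·S_W` IS `−βcκ·Z`**, as routines `GaugeConfig → momenta`
(the form consumed by the kernel theorems of `U1FTHMCGaugeCovariance` / `U1FTHMCTranslationCovariance`). -/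
theorem u1ExactForceRoutine_eq_flowField (hL : 2 ≤ L) (β c κ : ℝ) :
    (fun V : GaugeConfig d L Circle => (fun i : Edge d L => κ * fderiv ℝ (fun p : (Edge d L → ℝ) => (fun W : GaugeConfig d L Circle => β * wilsonAction u1Rep W) ((fun i : Edge d L => Circle.exp (c * p i)) * V)) 0 (Pi.single i 1))) =
      (fun V : GaugeConfig d L Circle => (fun e : Edge d L => -(β * c * κ) * ∑ ν ∈ Finset.univ.erase e.2,
            (((plaquetteHolonomy V (e.1 - Pi.single ν 1) e.2 ν : Circle) : ℂ).im -
              ((plaquetteHolonomy V e.1 e.2 ν : Circle) : ℂ).im))) :=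
  funext fun V => u1ExactForce_wilson hL β c κ V

end Main

end Summit.Ventures.LatticeQCDFlow.Exactness
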